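import Mathlib.Analysis.SpecialFunctions.Pow.Real
import HarnessLib

/-!
# Chen–Tell exponent bookkeeping (`stub_bootstrapArith`, line `Sketch`, crux `CircuitNpTc0`)

Pure real analysis.  For an abstract solvability predicate `S depth wires length`, monotone in
depth and wires, an initial polynomial wire bound `(n+2)^k` at depth `d₀` and the Allender–Koucký
block recursion (`hrec`) yield, for some `c > 1` and all large depths `Δ`, the wire bound
`K · (⌈n^{1+c^{-Δ}}⌉₊ + 1)` at depth `Δ`.

Proof.  WLOG `k ≥ 2`.  One round (`round_step`): if depth `D` achieves `K · (⌈n^{1+e}⌉₊ + 1)` wires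
(`0 < e ≤ k-1`), cut the `n/7` letters into `B = n/7/t + 1` blocks of `t = ⌈n^{e/k}⌉₊ ⊔ 1` letters;
the block circuits (initial bound at length `7t+7`) cost `128·B·((7t+9)^k+8) = O(n^{1-e/k}·n^{e})`
wires and the outer circuit on `7B = O(n^{1-e/k})` bits costs `O(n^{(1-e/k)(1+e)})`; both exponents
are `≤ 1 + e(k-1)/k`, so depth `d₀ + D + 2` achieves exponent `1 + e·(k-1)/k` (`round_bound` is the
real-variable estimate).  Iterating (`iterate`), depth `d₀ + j(d₀+2)` achieves excess
`(k-1)·((k-1)/k)^j`.  With `c := (k/(k-1))^{1/(2(d₀+2))} > 1` and `j := (Δ-d₀)/(d₀+2)` this excess is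
`≤ c^{-Δ}` for all large `Δ`, and monotonicity in depth and wires concludes.
-/

-- `Summit.<Summit>.<Problem>`: for the single-conjunct summit `PneNP` the duplicate `PneNP.PneNP` is mandated (D-0017).
set_option linter.dupNamespace false

namespace Summit.PneNP.PneNP.Cruxes.CircuitNpTc0.Sketch

/-- The initial bound in bootstrapping form: `(n+2)^k ≤ 3^k · (n^k + 1)`. -/
private lemma init_bound (k n : ℕ) : (n + 2) ^ k ≤ 3 ^ k * (n ^ k + 1) := by
  rcases Nat.eq_zero_or_pos n with rfl | hn
  · calc (0 + 2) ^ k ≤ 3 ^ k := Nat.pow_le_pow_left (by norm_num) k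
      _ ≤ 3 ^ k * (0 ^ k + 1) := Nat.le_mul_of_pos_right _ (Nat.succ_pos _)
  · calc (n + 2) ^ k ≤ (3 * n) ^ k := Nat.pow_le_pow_left (by omega) k
      _ = 3 ^ k * n ^ k := mul_pow 3 n k
      _ ≤ 3 ^ k * (n ^ k + 1) := Nat.mul_le_mul_left _ (Nat.le_succ _)

/-- **The real-variable estimate of one bootstrapping round.** With `β = e/k`, block length
`t ∈ [n^β, n^β + 2]`, `t ≥ 1`, and `B ≤ n/(7t) + 1` blocks, the recursion cost
`128·B·((7t+9)^k + 8) + K·(⌈(7B)^{1+e}⌉₊ + 1) + 8` is at most `K'·(⌈n^{1+e(k-1)/k}⌉₊ + 1)` for a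
constant `K'` depending only on `k, e, K`. -/
private lemma round_bound {k : ℕ} (hk : 2 ≤ k) {e : ℝ} (he : 0 < e) (hek : e ≤ k - 1) (K : ℕ) :
    ∃ K' : ℕ, ∀ n t B : ℕ, 1 ≤ t → (n : ℝ) ^ (e / k) ≤ t → (t : ℝ) ≤ (n : ℝ) ^ (e / k) + 2 →
      (B : ℝ) ≤ (n : ℝ) / 7 / t + 1 →
      128 * B * ((7 * t + 7 + 2) ^ k + 8) + K * (⌈((7 * B : ℕ) : ℝ) ^ (1 + e)⌉₊ + 1) + 8
        ≤ K' * (⌈(n : ℝ) ^ (1 + e * ((k - 1) / k))⌉₊ + 1) := by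
  -- basic facts about `k`
  have hk2 : (2 : ℝ) ≤ k := by exact_mod_cast hk
  have hk0 : (0 : ℝ) < k := by linarith
  have hkne : (k : ℝ) ≠ 0 := hk0.ne'
  -- the exponents
  set β : ℝ := e / k with hβ
  set e' : ℝ := e * ((k - 1) / k) with he'
  have hβ0 : 0 < β := div_pos he hk0
  have hβ1 : β < 1 := by rw [hβ, div_lt_one hk0]; linarith
  have he'0 : 0 < e' := mul_pos he (div_pos (by linarith) hk0)
  have hexp1 : (1 - β) + (k : ℝ) * β = 1 + e' := by
    rw [hβ, he']; field_simp; ring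
  have hexp2 : (1 - β) * (1 + e) ≤ 1 + e' := by
    have h1 : (1 - β) * (1 + e) = 1 + e' - e ^ 2 / k := by
      rw [hβ, he']; field_simp; ring
    have h2 : (0 : ℝ) ≤ e ^ 2 / k := by positivity
    linarith
  -- the constant
  set C : ℝ := 256 * (30 ^ k + 8) + K * ((8 : ℝ) ^ (1 + e) + 2) + 8 with hC
  have hC0 : 0 ≤ C := by positivity
  refine ⟨⌈C⌉₊, fun n t B ht1 htlo hthi hB => ?_⟩
  -- pass to `ℝ`; `z := max n 1 ≥ 1` dominates `n`
  have ht1' : (1 : ℝ) ≤ t := by exact_mod_cast ht1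
  have hn0 : (0 : ℝ) ≤ n := Nat.cast_nonneg n
  set z : ℝ := max (n : ℝ) 1 with hz
  have hz1 : 1 ≤ z := le_max_right _ _
  have hz0 : 0 < z := by linarith
  have hnz : (n : ℝ) ≤ z := le_max_left _ _
  have hzpow : ∀ γ : ℝ, 0 ≤ γ → 1 ≤ z ^ γ := fun γ hγ => Real.one_le_rpow hz1 hγ
  -- (A) the block length: `t ≤ 3 z^β`
  have hA : (t : ℝ) ≤ 3 * z ^ β := by
    have h1 : (n : ℝ) ^ β ≤ z ^ β := Real.rpow_le_rpow hn0 hnz hβ0.le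
    have h2 := hzpow β hβ0.le
    linarith
  -- (B) the block circuits: `(7t+9)^k + 8 ≤ (30^k + 8) z^{kβ}`
  have hBk : ((7 * (t : ℝ) + 7 + 2) ^ k + 8) ≤ (30 ^ k + 8) * z ^ ((k : ℝ) * β) := by
    have h0 := hzpow β hβ0.le
    have h1 : 7 * (t : ℝ) + 7 + 2 ≤ 30 * z ^ β := by linarith
    have h2 : (7 * (t : ℝ) + 7 + 2) ^ k ≤ (30 * z ^ β) ^ k :=
      pow_le_pow_left₀ (by positivity) h1 k
    have h3 : (30 * z ^ β) ^ k = 30 ^ k * z ^ ((k : ℝ) * β) := by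
      rw [mul_pow, mul_comm (k : ℝ) β, Real.rpow_mul_natCast hz0.le]
    have h4 := hzpow ((k : ℝ) * β) (by positivity)
    rw [h3] at h2
    linarith
  -- (C) the number of blocks: `n/t ≤ z^{1-β}`, so `B ≤ z^{1-β}/7 + 1`
  have hnt : (n : ℝ) / t ≤ z ^ (1 - β) := by
    rcases Nat.eq_zero_or_pos n with hn | hn
    · rw [hn, Nat.cast_zero, zero_div]; positivity
    · have hn1 : (1 : ℝ) ≤ n := by exact_mod_cast hn
      have hnpos : (0 : ℝ) < n := by linarith
      have hzn : z = n := max_eq_left hn1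
      calc (n : ℝ) / t ≤ n / (n : ℝ) ^ β :=
            div_le_div_of_nonneg_left hn0 (Real.rpow_pos_of_pos hnpos β) htlo
        _ = z ^ (1 - β) := by rw [hzn, Real.rpow_sub hnpos, Real.rpow_one]
  have hB' : (B : ℝ) ≤ z ^ (1 - β) / 7 + 1 := by
    have h1 : (n : ℝ) / 7 / t = (n : ℝ) / t / 7 := div_right_comm _ _ _
    have h2 : (n : ℝ) / t / 7 ≤ z ^ (1 - β) / 7 :=
      div_le_div_of_nonneg_right hnt (by norm_num)
    linarith
  have h1β := hzpow (1 - β) (by linarith)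
  have hBz : (B : ℝ) ≤ 2 * z ^ (1 - β) := by linarith
  have h7B : 7 * (B : ℝ) ≤ 8 * z ^ (1 - β) := by linarith
  -- (D) the first term
  have hz1e : z ^ (1 - β) * z ^ ((k : ℝ) * β) = z ^ (1 + e') := by
    rw [← Real.rpow_add hz0, hexp1]
  have hD : 128 * (B : ℝ) * ((7 * (t : ℝ) + 7 + 2) ^ k + 8)
      ≤ 256 * (30 ^ k + 8) * z ^ (1 + e') := by
    have h2 : (0 : ℝ) ≤ (7 * (t : ℝ) + 7 + 2) ^ k + 8 := by positivity
    calc 128 * (B : ℝ) * ((7 * (t : ℝ) + 7 + 2) ^ k + 8)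
        ≤ 128 * (2 * z ^ (1 - β)) * ((30 ^ k + 8) * z ^ ((k : ℝ) * β)) := by
          apply mul_le_mul ?_ hBk h2 (by positivity)
          exact mul_le_mul_of_nonneg_left hBz (by norm_num)
      _ = 256 * (30 ^ k + 8) * (z ^ (1 - β) * z ^ ((k : ℝ) * β)) := by ring
      _ = 256 * (30 ^ k + 8) * z ^ (1 + e') := by rw [hz1e]
  -- (E) the second term
  have hE : ((⌈(7 * (B : ℝ)) ^ (1 + e)⌉₊ : ℝ) + 1) ≤ ((8 : ℝ) ^ (1 + e) + 2) * z ^ (1 + e') := by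
    have h0 : (0 : ℝ) ≤ 7 * (B : ℝ) := by positivity
    have h1 : (7 * (B : ℝ)) ^ (1 + e) ≤ (8 * z ^ (1 - β)) ^ (1 + e) :=
      Real.rpow_le_rpow h0 h7B (by linarith)
    have h2 : (8 * z ^ (1 - β)) ^ (1 + e) = (8 : ℝ) ^ (1 + e) * z ^ ((1 - β) * (1 + e)) := by
      rw [Real.mul_rpow (by norm_num) (by positivity), ← Real.rpow_mul hz0.le]
    have h3 : z ^ ((1 - β) * (1 + e)) ≤ z ^ (1 + e') :=
      Real.rpow_le_rpow_of_exponent_le hz1 hexp2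
    have h4 : (0 : ℝ) ≤ (8 : ℝ) ^ (1 + e) := by positivity
    have h5 : ((⌈(7 * (B : ℝ)) ^ (1 + e)⌉₊ : ℝ)) < (7 * (B : ℝ)) ^ (1 + e) + 1 :=
      Nat.ceil_lt_add_one (by positivity)
    have h6 := hzpow (1 + e') (by linarith)
    have h7 := mul_le_mul_of_nonneg_left h3 h4
    rw [h2] at h1
    linarith
  -- (G) compare `z^{1+e'}` with the target ceiling
  have hG : z ^ (1 + e') ≤ (⌈(n : ℝ) ^ (1 + e')⌉₊ : ℝ) + 1 := by
    rcases Nat.eq_zero_or_pos n with hn | hn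
    · have hz' : z = 1 := by
        rw [hz, hn, Nat.cast_zero]; exact max_eq_right zero_le_one
      rw [hz', Real.one_rpow]
      have : (0 : ℝ) ≤ (⌈(n : ℝ) ^ (1 + e')⌉₊ : ℝ) := Nat.cast_nonneg _
      linarith
    · have hn1 : (1 : ℝ) ≤ n := by exact_mod_cast hn
      have hzn : z = n := max_eq_left hn1
      rw [hzn]
      have := Nat.le_ceil ((n : ℝ) ^ (1 + e'))
      linarith
  -- assemble over `ℝ`, then cast back to `ℕ`
  have hK0 : (0 : ℝ) ≤ K := Nat.cast_nonneg K
  have hKE := mul_le_mul_of_nonneg_left hE hK0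
  have h6 := hzpow (1 + e') (by linarith)
  have hreal : (128 * (B : ℝ) * ((7 * (t : ℝ) + 7 + 2) ^ k + 8)
      + K * (((⌈(7 * (B : ℝ)) ^ (1 + e)⌉₊ : ℝ) + 1)) + 8)
      ≤ (⌈C⌉₊ : ℝ) * ((⌈(n : ℝ) ^ (1 + e')⌉₊ : ℝ) + 1) := by
    calc _ ≤ C * z ^ (1 + e') := by rw [hC]; linarith
      _ ≤ C * ((⌈(n : ℝ) ^ (1 + e')⌉₊ : ℝ) + 1) := mul_le_mul_of_nonneg_left hG hC0
      _ ≤ (⌈C⌉₊ : ℝ) * ((⌈(n : ℝ) ^ (1 + e')⌉₊ : ℝ) + 1) :=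
          mul_le_mul_of_nonneg_right (Nat.le_ceil C) (by positivity)
  exact_mod_cast hreal

/-- **One bootstrapping round.** From the initial bound at depth `d₀` and the bound
`K · (⌈n^{1+e}⌉₊ + 1)` at depth `D`, the block recursion gives `K' · (⌈n^{1+e(k-1)/k}⌉₊ + 1)` at
depth `d₀ + D + 2`. -/
private lemma round_step (S : ℕ → ℕ → ℕ → Prop)
    (hmono : ∀ d d' W W' n : ℕ, d ≤ d' → W ≤ W' → S d W n → S d' W' n)
    (hrec : ∀ t : ℕ, 0 < t → ∀ n B : ℕ, n / 7 ≤ t * B → ∀ d₁ d₂ W₁ W₂ : ℕ,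
      S d₁ W₁ (7 * t + 7) → S d₂ W₂ (7 * B) → S (d₁ + d₂ + 2) (128 * B * (W₁ + 8) + W₂ + 8) n)
    {d₀ k : ℕ} (hk : 2 ≤ k) (hinit : ∀ n : ℕ, S d₀ ((n + 2) ^ k) n)
    {e : ℝ} (he : 0 < e) (hek : e ≤ k - 1) {D K : ℕ}
    (hD : ∀ n : ℕ, S D (K * (⌈(n : ℝ) ^ (1 + e)⌉₊ + 1)) n) :
    ∃ K' : ℕ, ∀ n : ℕ, S (d₀ + D + 2) (K' * (⌈(n : ℝ) ^ (1 + e * ((k - 1) / k))⌉₊ + 1)) n := by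
  obtain ⟨K', hK'⟩ := round_bound hk he hek K
  refine ⟨K', fun n => ?_⟩
  obtain ⟨t, ht⟩ : ∃ t : ℕ, t = max ⌈(n : ℝ) ^ (e / k)⌉₊ 1 := ⟨_, rfl⟩
  have ht1 : 1 ≤ t := by rw [ht]; exact le_max_right _ _
  obtain ⟨B, hB⟩ : ∃ B : ℕ, B = n / 7 / t + 1 := ⟨_, rfl⟩
  have hdiv : n / 7 ≤ t * B := by
    have h1 := Nat.div_add_mod (n / 7) t
    have h2 := Nat.mod_lt (n / 7) ht1
    rw [hB, Nat.mul_add, mul_one]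
    omega
  have h3 := hrec t ht1 n B hdiv d₀ D _ _ (hinit (7 * t + 7)) (hD (7 * B))
  refine hmono _ _ _ _ n le_rfl ?_ h3
  refine hK' n t B ht1 ?_ ?_ ?_
  · have h : (⌈(n : ℝ) ^ (e / k)⌉₊ : ℝ) ≤ (t : ℝ) := by
      have : ⌈(n : ℝ) ^ (e / k)⌉₊ ≤ t := by rw [ht]; exact le_max_left _ _
      exact_mod_cast this
    exact (Nat.le_ceil _).trans h
  · have h0 : (0 : ℝ) ≤ (n : ℝ) ^ (e / k) := by positivity
    have hc := Nat.ceil_lt_add_one h0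
    have h5 : t ≤ ⌈(n : ℝ) ^ (e / k)⌉₊ + 1 := by
      rw [ht]; exact max_le (Nat.le_succ _) (by omega)
    have h6 : (t : ℝ) ≤ (⌈(n : ℝ) ^ (e / k)⌉₊ : ℝ) + 1 := by exact_mod_cast h5
    linarith
  · have htpos : (0 : ℝ) < t := by exact_mod_cast ht1
    have h1 : ((n / 7 / t : ℕ) : ℝ) ≤ ((n / 7 : ℕ) : ℝ) / t := Nat.cast_div_le
    have h2 : ((n / 7 : ℕ) : ℝ) ≤ (n : ℝ) / 7 := Nat.cast_div_le
    have h4 : ((n / 7 : ℕ) : ℝ) / t ≤ (n : ℝ) / 7 / t := div_le_div_of_nonneg_right h2 htpos.le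
    rw [hB]; push_cast
    linarith

/-- **Iterating the rounds.** Depth `d₀ + j·(d₀+2)` achieves exponent excess `(k-1)·((k-1)/k)^j`. -/
private lemma iterate (S : ℕ → ℕ → ℕ → Prop)
    (hmono : ∀ d d' W W' n : ℕ, d ≤ d' → W ≤ W' → S d W n → S d' W' n)
    (hrec : ∀ t : ℕ, 0 < t → ∀ n B : ℕ, n / 7 ≤ t * B → ∀ d₁ d₂ W₁ W₂ : ℕ,
      S d₁ W₁ (7 * t + 7) → S d₂ W₂ (7 * B) → S (d₁ + d₂ + 2) (128 * B * (W₁ + 8) + W₂ + 8) n)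
    {d₀ k : ℕ} (hk : 2 ≤ k) (hinit : ∀ n : ℕ, S d₀ ((n + 2) ^ k) n) (j : ℕ) :
    ∃ K : ℕ, ∀ n : ℕ,
      S (d₀ + j * (d₀ + 2))
        (K * (⌈(n : ℝ) ^ (1 + ((k : ℝ) - 1) * (((k : ℝ) - 1) / k) ^ j)⌉₊ + 1)) n := by
  induction j with
  | zero =>
    refine ⟨3 ^ k, fun n => ?_⟩
    have h1 : (1 : ℝ) + ((k : ℝ) - 1) * (((k : ℝ) - 1) / k) ^ 0 = ((k : ℕ) : ℝ) := by ring
    rw [h1, Real.rpow_natCast, ← Nat.cast_pow, Nat.ceil_natCast, zero_mul, add_zero]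
    exact hmono _ _ _ _ n le_rfl (init_bound k n) (hinit n)
  | succ j ih =>
    obtain ⟨K, hK⟩ := ih
    have hk2 : (2 : ℝ) ≤ k := by exact_mod_cast hk
    have hr0 : 0 < ((k : ℝ) - 1) / k := div_pos (by linarith) (by linarith)
    have hr1 : ((k : ℝ) - 1) / k ≤ 1 := (div_le_one (by linarith)).mpr (by linarith)
    have he : 0 < ((k : ℝ) - 1) * (((k : ℝ) - 1) / k) ^ j := mul_pos (by linarith) (pow_pos hr0 j)
    have hek : ((k : ℝ) - 1) * (((k : ℝ) - 1) / k) ^ j ≤ k - 1 := by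
      have h1 : (((k : ℝ) - 1) / k) ^ j ≤ 1 := pow_le_one₀ hr0.le hr1
      have h2 : (0 : ℝ) ≤ (k : ℝ) - 1 := by linarith
      calc ((k : ℝ) - 1) * (((k : ℝ) - 1) / k) ^ j
          ≤ ((k : ℝ) - 1) * 1 := mul_le_mul_of_nonneg_left h1 h2
        _ = k - 1 := mul_one _
    obtain ⟨K', hK'⟩ := round_step S hmono hrec hk hinit he hek hK
    refine ⟨K', fun n => ?_⟩
    have hd : d₀ + (j + 1) * (d₀ + 2) = d₀ + (d₀ + j * (d₀ + 2)) + 2 := by ring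
    have hexp : (1 : ℝ) + ((k : ℝ) - 1) * (((k : ℝ) - 1) / k) ^ (j + 1)
        = 1 + ((k : ℝ) - 1) * (((k : ℝ) - 1) / k) ^ j * (((k : ℝ) - 1) / k) := by ring
    rw [hd, hexp]
    exact hK' n

/-- **stub_bootstrapArith — the Chen–Tell exponent bookkeeping (M; pure real analysis).** For an
abstract solvability predicate `S depth wires length`, monotone in depth and wires, a polynomial
initial bound `(n+2)^k` at some depth and the block recursion of `stub_selfReduction` give, for some
`c > 1` and all large depths `Δ`, the wire bound `K · (⌈n^{1+c^{-Δ}}⌉ + 1)`: with `t ≈ n^{e/k}` one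
round turns exponent `1+e` at depth `D` into `1 + e·(k-1)/k` at depth `D + d₀ + 2`, so after `j`
rounds the excess is `(k-1)((k-1)/k)^j`, i.e. `≤ c^{-Δ}` for `c = (k/(k-1))^{1/(2(d₀+2))}` and `Δ`
large (monotonicity in depth fills the gaps; `k ≤ 1` is absorbed by `k ⊔ 2`).
[cite: ChenTell2019, Thm. 1.1 (proof: bootstrapping the Allender–Koucký recursion)] -/
theorem stub_bootstrapArith (S : ℕ → ℕ → ℕ → Prop)
    (hmono : ∀ d d' W W' n : ℕ, d ≤ d' → W ≤ W' → S d W n → S d' W' n)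
    (hinit : ∃ d₀ k : ℕ, ∀ n : ℕ, S d₀ ((n + 2) ^ k) n)
    (hrec : ∀ t : ℕ, 0 < t → ∀ n B : ℕ, n / 7 ≤ t * B → ∀ d₁ d₂ W₁ W₂ : ℕ,
      S d₁ W₁ (7 * t + 7) → S d₂ W₂ (7 * B) → S (d₁ + d₂ + 2) (128 * B * (W₁ + 8) + W₂ + 8) n) :
    ∃ c : ℝ, 1 < c ∧ ∃ Δ₁ : ℕ, ∀ Δ : ℕ, Δ₁ ≤ Δ → ∃ K : ℕ, ∀ n : ℕ,
      S Δ (K * (⌈(n : ℝ) ^ (1 + (c ^ Δ)⁻¹)⌉₊ + 1)) n := by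
  obtain ⟨d₀, k₀, hinit₀⟩ := hinit
  -- bump the initial exponent to some `k ≥ 2`
  obtain ⟨k, hk, hkk⟩ : ∃ k : ℕ, 2 ≤ k ∧ k₀ ≤ k := ⟨max k₀ 2, le_max_right _ _, le_max_left _ _⟩
  have hinit' : ∀ n : ℕ, S d₀ ((n + 2) ^ k) n := fun n =>
    hmono _ _ _ _ n le_rfl (Nat.pow_le_pow_right (by omega) hkk) (hinit₀ n)
  have hk2 : (2 : ℝ) ≤ k := by exact_mod_cast hk
  -- the rate: `c := (k/(k-1))^{1/P}` with `P := 2(d₀+2)`, so `c^P = k/(k-1)`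
  obtain ⟨P, hP⟩ : ∃ P : ℕ, P = 2 * (d₀ + 2) := ⟨_, rfl⟩
  have hP0 : (0 : ℝ) < P := by exact_mod_cast (show 0 < P by omega)
  have hq1 : (1 : ℝ) < (k : ℝ) / ((k : ℝ) - 1) := by
    rw [one_lt_div (by linarith)]; linarith
  have hq0 : (0 : ℝ) ≤ (k : ℝ) / ((k : ℝ) - 1) := by linarith
  obtain ⟨c, hc⟩ : ∃ c : ℝ, c = ((k : ℝ) / ((k : ℝ) - 1)) ^ ((P : ℝ)⁻¹) := ⟨_, rfl⟩
  have hc1 : 1 < c := by rw [hc]; exact Real.one_lt_rpow hq1 (inv_pos.mpr hP0)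
  have hcP : c ^ P = (k : ℝ) / ((k : ℝ) - 1) := by
    rw [hc]; exact Real.rpow_inv_natCast_pow hq0 (by omega)
  have hc0 : 0 < c := by linarith
  obtain ⟨N₀, hN₀⟩ := pow_unbounded_of_one_lt ((k : ℝ) - 1) hc1
  refine ⟨c, hc1, 4 * (d₀ + 2) + N₀, fun Δ hΔ => ?_⟩
  obtain ⟨Δ', rfl⟩ := Nat.exists_eq_add_of_le (show d₀ ≤ Δ by omega)
  -- the number of completed rounds at depth `d₀ + Δ'`
  obtain ⟨j, hj⟩ : ∃ j : ℕ, j = Δ' / (d₀ + 2) := ⟨_, rfl⟩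
  have hj1 : (d₀ + 2) * j ≤ Δ' := by rw [hj]; exact Nat.mul_div_le Δ' (d₀ + 2)
  have hj2 : Δ' < (d₀ + 2) * j + (d₀ + 2) := by
    have h1 := Nat.div_add_mod Δ' (d₀ + 2)
    have h2 := Nat.mod_lt Δ' (show 0 < d₀ + 2 by omega)
    rw [hj]; omega
  obtain ⟨K, hK⟩ := iterate S hmono hrec hk hinit' j
  refine ⟨K, fun n => hmono _ _ _ _ n ?_ ?_ (hK n)⟩
  · -- depth: `d₀ + j(d₀+2) ≤ d₀ + Δ'`
    have : j * (d₀ + 2) = (d₀ + 2) * j := mul_comm _ _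
    omega
  · -- wires: the excess `(k-1)((k-1)/k)^j` is at most `c^{-(d₀+Δ')}`
    have hr : ((k : ℝ) - 1) / k = (c ^ P)⁻¹ := by rw [hcP, inv_div]
    have hr0 : 0 < ((k : ℝ) - 1) / k := div_pos (by linarith) (by linarith)
    have hej : 0 < ((k : ℝ) - 1) * (((k : ℝ) - 1) / k) ^ j := mul_pos (by linarith) (pow_pos hr0 j)
    have hle : ((k : ℝ) - 1) * (((k : ℝ) - 1) / k) ^ j ≤ (c ^ (d₀ + Δ'))⁻¹ := by
      rw [hr, inv_pow, ← pow_mul, ← div_eq_mul_inv, div_le_iff₀ (pow_pos hc0 _),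
        ← div_eq_inv_mul, le_div_iff₀ (pow_pos hc0 _)]
      have hPj : N₀ + (d₀ + Δ') ≤ P * j := by
        have : P * j = 2 * ((d₀ + 2) * j) := by rw [hP, mul_assoc]
        omega
      calc ((k : ℝ) - 1) * c ^ (d₀ + Δ') ≤ c ^ N₀ * c ^ (d₀ + Δ') :=
            mul_le_mul_of_nonneg_right hN₀.le (pow_nonneg hc0.le _)
        _ = c ^ (N₀ + (d₀ + Δ')) := (pow_add _ _ _).symm
        _ ≤ c ^ (P * j) := pow_le_pow_right₀ hc1.le hPj
    apply Nat.mul_le_mul_left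
    apply Nat.add_le_add_right
    apply Nat.ceil_le_ceil
    rcases Nat.eq_zero_or_pos n with hn | hn
    · have h0 : (n : ℝ) = 0 := by exact_mod_cast hn
      have hne1 : (1 : ℝ) + ((k : ℝ) - 1) * (((k : ℝ) - 1) / k) ^ j ≠ 0 := by linarith
      have hne2 : (1 : ℝ) + (c ^ (d₀ + Δ'))⁻¹ ≠ 0 := (by positivity : (0 : ℝ) < _).ne'
      rw [h0, Real.zero_rpow hne1, Real.zero_rpow hne2]
    · exact Real.rpow_le_rpow_of_exponent_le (by exact_mod_cast hn) (by linarith)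

end Summit.PneNP.PneNP.Cruxes.CircuitNpTc0.Sketch
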